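import Mathlib
import Literature.AlgebraicGeometry.Resolution.PowerSeriesPBasis
import HarnessLib

/-!
# Crux `Steer` (stmt-ResolutionOfSingularities-16345), chain W4.1, p = 2 σ-residual, HIGH half, B4 —
# order raising in the power series ring (characteristic two, perfect coefficients)

OURS (campaign `res-hironaka`, rung L ★L-G4, slot W4.1; seat res-type-096 g8; lemma «C» of the B4 plan
`noHeightOneCarrier_two`, res-L0-w41-plan-1 RULING 3, SIZING line 2026-08-27T07:59:27Z; replaces the role of no printed
item; NOT a statement of the manuscript under review; AI-produced, weaker than expert review).

The DERIVATIVE-FREE order-raising step of B4's deep-carrier case, in the model `S = κ⟦X₁, …, Xₙ⟧` with `κ` perfect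
of characteristic two. Every `φ ∈ S` is uniquely `φ = Σ_e X^{ν(e)} φ_e` over the residues `e ∈ {0,1}ⁿ` with
`φ_e ∈ κ⟦X²⟧ = S²` (tree `PowerSeriesPBasis`: `eq_sum_pComponent`, `pComponent_eq_of_eq_sum`,
`exists_pow_eq_of_forall_coeff`), and squares act diagonally on this decomposition. Hence:

* `OrderRaising.exists_sq_sub_mem_pow_five` — if `d² f − a² = u² m` in `S` with `u ∈ 𝔫²` and `d` a non-zero-divisor
  modulo `u` (`u ∣ d G ⇒ u ∣ G`), then `f − G² ∈ 𝔫⁵` for some `G`: componentwise `d² f_e = u² m_e` (`e ≠ 0`), so with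
  `f_e = G_e²`, `m_e = M_e²` one gets `d G_e = u M_e`, `u ∣ G_e`, `f_e ∈ u² S² ⊆ 𝔫⁴`, and `X^{ν(e)} f_e ∈ 𝔫⁵`.

The transfer to an arbitrary regular local ring with perfect residue field (completion + Cohen structure theorem) is the
sequel `FrobeniusClosingSteerOrderRaising.lean`. [cite: Matsumura1987, §30 p. 243, proof of Thm. 30.9] [folklore]
-/

noncomputable section

-- `Summit.<S>.<S>.…` duplicates the summit name by design (single-problem summit).
set_option linter.dupNamespace false

open MvPowerSeries IsLocalRing

namespace Summit.ResolutionOfSingularities.ResolutionOfSingularities.Theorems.SwitchingDichotomy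

namespace OrderRaising

open Literature.AlgebraicGeometry.Resolution

universe u

variable {k : Type u} [Field k] [CharP k 2] {n : ℕ}

/-- In characteristic two, `a² − b² = (a − b)²`. [folklore] -/
theorem sq_sub_sq {A : Type*} [CommRing A] [CharP A 2] (a b : A) : a ^ 2 - b ^ 2 = (a - b) ^ 2 := by
  have h2 : (2 : A) = 0 := by exact_mod_cast CharP.cast_eq_zero A 2
  linear_combination (a * b - b ^ 2) * h2

/-- In a reduced ring of characteristic two, `a² = b²` forces `a = b`. [folklore] -/
theorem eq_of_sq_eq_sq {A : Type*} [CommRing A] [CharP A 2] [IsReduced A] {a b : A} (h : a ^ 2 = b ^ 2) :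
    a = b := by
  have h0 : (a - b) ^ 2 = 0 := by rw [← sq_sub_sq, h, sub_self]
  exact sub_eq_zero.mp (IsReduced.eq_zero _ ⟨2, h0⟩)

/-- A `⊤`-basis of `k` consisting of `1`. [folklore] -/
theorem exists_basis_top_apply_eq_one (k : Type u) [Field k] :
    ∃ b : Module.Basis Unit (⊤ : Subfield k) k, b () = 1 := by
  have hli : LinearIndependent (⊤ : Subfield k) (fun _ : Unit => (1 : k)) := by
    rw [linearIndependent_unique_iff]
    exact one_ne_zero
  have hsp : ⊤ ≤ Submodule.span (⊤ : Subfield k) (Set.range fun _ : Unit => (1 : k)) := by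
    intro x _
    have hx : x = (⟨x, trivial⟩ : (⊤ : Subfield k)) • (1 : k) := by
      rw [Subfield.smul_def]; simp
    rw [hx]
    exact Submodule.smul_mem _ _ (Submodule.subset_span ⟨(), rfl⟩)
  exact ⟨Module.Basis.mk hli hsp, by rw [Module.Basis.mk_apply]⟩

/-- Over a PERFECT field of characteristic two, every element of `κ⟦X²⟧` is a square in `κ⟦X⟧`. [folklore] -/
theorem exists_sq_eq_of_mem (hk : ∀ a : k, ∃ b : k, b ^ 2 = a) (ψ : MvPowerSeries (Fin n) k)
    (hψ : ψ ∈ pSeriesSubring (n := n) 2 (⊤ : Subfield k)) :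
    ∃ φ : MvPowerSeries (Fin n) k, φ ^ 2 = ψ := by
  haveI : Fact (Nat.Prime 2) := ⟨Nat.prime_two⟩
  exact exists_pow_eq_of_forall_coeff 2 ψ (fun m => hk _) (fun m hm => ((hψ m).2 hm))

/-- Squares lie in `κ⟦X²⟧`. [folklore] -/
theorem sq_mem (φ : MvPowerSeries (Fin n) k) : φ ^ 2 ∈ pSeriesSubring (n := n) 2 (⊤ : Subfield k) := by
  haveI : Fact (Nat.Prime 2) := ⟨Nat.prime_two⟩
  exact pow_char_mem_pSeriesSubring 2 ⊤ (fun _ => trivial) φ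

omit [CharP k 2] in
/-- A monomial `X^{ν(e)}` with `e ≠ 0` lies in the maximal ideal of `κ⟦X⟧`. [folklore] -/
theorem monomial_residueExponent_mem_maximalIdeal {e : Fin n → Fin 2} (he : e ≠ 0) :
    monomial (residueExponent 2 e) (1 : k) ∈ maximalIdeal (MvPowerSeries (Fin n) k) := by
  rw [IsLocalRing.mem_maximalIdeal, mem_nonunits_iff, MvPowerSeries.isUnit_iff_constantCoeff]
  have hne : residueExponent 2 e ≠ 0 := by
    intro h0
    apply he
    funext i
    have := congrArg (fun m => m i) h0
    rw [residueExponent_apply] at this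
    exact Fin.ext (by simpa using this)
  rw [← coeff_zero_eq_constantCoeff_apply, coeff_monomial, if_neg (Ne.symm hne)]
  exact not_isUnit_zero

/-- **Order raising in `κ⟦X⟧` (κ perfect, characteristic two).** If `d² f − a² = u² m` with `u ∈ 𝔫²` and `d` a
non-zero-divisor modulo `u` (`u ∣ d·G ⇒ u ∣ G`), then `f − G² ∈ 𝔫⁵` for some `G ∈ κ⟦X⟧`. Proof: decompose
`f = Σ_e X^{ν(e)} f_e`, `m = Σ_e X^{ν(e)} m_e` with `f_e, m_e ∈ κ⟦X²⟧`; since `d², a², u²` lie in `κ⟦X²⟧`, uniqueness of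
the decomposition of `d² f − a² = u² m` gives `d² f_e = u² m_e` for `e ≠ 0`; writing `f_e = G_e²`, `m_e = M_e²`
(perfectness) yields `d G_e = u M_e`, so `u ∣ G_e` and `X^{ν(e)} f_e ∈ u² 𝔫 ⊆ 𝔫⁵`; finally `f − G₀² = Σ_{e ≠ 0} X^{ν(e)} f_e`.
[cite: Matsumura1987, §30 p. 243, proof of Thm. 30.9] [folklore] -/
theorem exists_sq_sub_mem_pow_five (hk : ∀ a : k, ∃ b : k, b ^ 2 = a) {u d f a m : MvPowerSeries (Fin n) k}
    (hu : u ∈ maximalIdeal (MvPowerSeries (Fin n) k) ^ 2)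
    (hnzd : ∀ G : MvPowerSeries (Fin n) k, u ∣ d * G → u ∣ G)
    (h : d ^ 2 * f - a ^ 2 = u ^ 2 * m) :
    ∃ G : MvPowerSeries (Fin n) k, f - G ^ 2 ∈ maximalIdeal (MvPowerSeries (Fin n) k) ^ 5 := by
  classical
  haveI : Fact (Nat.Prime 2) := ⟨Nat.prime_two⟩
  haveI : CharP (MvPowerSeries (Fin n) k) 2 := by
    refine charP_of_injective_algebraMap (R := k) (fun x y hxy => ?_) 2
    rw [MvPowerSeries.algebraMap_apply, MvPowerSeries.algebraMap_apply, Algebra.algebraMap_self,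
      RingHom.id_apply, RingHom.id_apply] at hxy
    exact MvPowerSeries.C_injective hxy
  set P := pSeriesSubring (n := n) 2 (⊤ : Subfield k) with hP
  obtain ⟨b, hb⟩ := exists_basis_top_apply_eq_one k
  -- components
  set c : MvPowerSeries (Fin n) k → (Fin n → Fin 2) → MvPowerSeries (Fin n) k := fun φ e => pComponent 2 (⊤ : Subfield k) b φ () e with hc
  have hcmem : ∀ φ e, c φ e ∈ P := fun φ e => pComponent_mem 2 ⊤ b φ () e
  have hexp : ∀ φ : MvPowerSeries (Fin n) k, φ = ∑ e : Fin n → Fin 2, monomial (residueExponent 2 e) (1 : k) * c φ e := by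
    intro φ
    have h1 := eq_sum_pComponent 2 (⊤ : Subfield k) b φ
    rw [Fintype.sum_unique] at h1
    simpa [hb] using h1
  -- the two presentations of `Φ = d² f − a² = u² m`
  set ψ : Unit → (Fin n → Fin 2) → MvPowerSeries (Fin n) k := fun _ e =>
    if e = 0 then d ^ 2 * c f 0 - a ^ 2 else d ^ 2 * c f e with hψdef
  set ψ' : Unit → (Fin n → Fin 2) → MvPowerSeries (Fin n) k := fun _ e => u ^ 2 * c m e with hψ'def
  have hψ : ∀ l e, ψ l e ∈ P := by
    intro l e
    by_cases he : e = 0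
    · simp only [hψdef, he, if_true]
      exact P.sub_mem (P.mul_mem (sq_mem d) (hcmem f 0)) (sq_mem a)
    · simp only [hψdef, he, if_false]
      exact P.mul_mem (sq_mem d) (hcmem f e)
  have hψ' : ∀ l e, ψ' l e ∈ P := fun l e => P.mul_mem (sq_mem u) (hcmem m e)
  have hν0 : monomial (residueExponent 2 (0 : Fin n → Fin 2)) (1 : k) = 1 := by
    have : residueExponent 2 (0 : Fin n → Fin 2) = 0 := by
      ext i; rw [residueExponent_apply]; rfl
    rw [this]; rfl
  have hΦ1 : d ^ 2 * f - a ^ 2 = ∑ l : Unit, ∑ e : Fin n → Fin 2,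
      MvPowerSeries.C (b l) * (monomial (residueExponent 2 e) (1 : k) * ψ l e) := by
    rw [Fintype.sum_unique]
    simp only [hb, map_one, one_mul]
    have hsplit : ∑ e : Fin n → Fin 2, monomial (residueExponent 2 e) (1 : k) * ψ () e =
        (∑ e : Fin n → Fin 2, monomial (residueExponent 2 e) (1 : k) * (d ^ 2 * c f e)) - a ^ 2 := by
      have key : ∀ e : Fin n → Fin 2, monomial (residueExponent 2 e) (1 : k) * ψ () e =
          monomial (residueExponent 2 e) (1 : k) * (d ^ 2 * c f e) -
            (if e = 0 then a ^ 2 else 0) := by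
        intro e
        by_cases he : e = 0
        · subst he; simp only [hψdef, if_true]; rw [hν0]; ring
        · simp only [hψdef, he, if_false, sub_zero]
      simp only [key, Finset.sum_sub_distrib, Finset.sum_ite_eq', Finset.mem_univ, if_true]
    rw [hsplit]
    congr 1
    conv_lhs => rw [hexp f]
    rw [Finset.mul_sum]
    refine Finset.sum_congr rfl fun e _ => ?_
    ring
  have hΦ2 : d ^ 2 * f - a ^ 2 = ∑ l : Unit, ∑ e : Fin n → Fin 2,
      MvPowerSeries.C (b l) * (monomial (residueExponent 2 e) (1 : k) * ψ' l e) := by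
    rw [h, Fintype.sum_unique]
    simp only [hb, map_one, one_mul]
    conv_lhs => rw [hexp m]
    rw [Finset.mul_sum]
    refine Finset.sum_congr rfl fun e _ => ?_
    simp only [hψ'def]; ring
  -- uniqueness: componentwise equality
  have hcomp : ∀ e : Fin n → Fin 2, e ≠ 0 → d ^ 2 * c f e = u ^ 2 * c m e := by
    intro e he
    have h1 := pComponent_eq_of_eq_sum 2 (⊤ : Subfield k) b ψ hψ _ hΦ1 () e
    have h2 := pComponent_eq_of_eq_sum 2 (⊤ : Subfield k) b ψ' hψ' _ hΦ2 () e
    rw [h1] at h2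
    simpa [hψdef, hψ'def, he] using h2
  -- each deep component is divisible by `u²`
  have hdeep : ∀ e : Fin n → Fin 2, e ≠ 0 → ∃ H : MvPowerSeries (Fin n) k, c f e = u ^ 2 * H ^ 2 := by
    intro e he
    obtain ⟨G, hG⟩ := exists_sq_eq_of_mem hk _ (hcmem f e)
    obtain ⟨M, hM⟩ := exists_sq_eq_of_mem hk _ (hcmem m e)
    have hsq : (d * G) ^ 2 = (u * M) ^ 2 := by rw [mul_pow, mul_pow, hG, hM]; exact hcomp e he
    have heq : d * G = u * M := eq_of_sq_eq_sq hsq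
    obtain ⟨H, hH⟩ := hnzd G ⟨M, heq⟩
    exact ⟨H, by rw [← hG, hH]; ring⟩
  -- assemble
  obtain ⟨G₀, hG₀⟩ := exists_sq_eq_of_mem hk _ (hcmem f 0)
  refine ⟨G₀, ?_⟩
  have hu4 : u ^ 2 ∈ maximalIdeal (MvPowerSeries (Fin n) k) ^ 4 := by
    have := Ideal.pow_mem_pow hu 2
    rwa [← pow_mul] at this
  have hrest : f - G₀ ^ 2 = ∑ e ∈ (Finset.univ.erase (0 : Fin n → Fin 2)),
      monomial (residueExponent 2 e) (1 : k) * c f e := by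
    rw [hG₀, Finset.sum_erase_eq_sub (Finset.mem_univ _), hν0, one_mul]
    exact congrArg (· - c f 0) (hexp f)
  rw [hrest]
  refine Ideal.sum_mem _ fun e he => ?_
  have he0 : e ≠ 0 := Finset.ne_of_mem_erase he
  obtain ⟨H, hH⟩ := hdeep e he0
  rw [hH, show monomial (residueExponent 2 e) (1 : k) * (u ^ 2 * H ^ 2) =
    (u ^ 2) * (monomial (residueExponent 2 e) (1 : k) * H ^ 2) by ring,
    show (5 : ℕ) = 4 + 1 by rfl, pow_add, pow_one]
  exact Ideal.mul_mem_mul hu4 (Ideal.mul_mem_right _ _ (monomial_residueExponent_mem_maximalIdeal he0))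

end OrderRaising

end Summit.ResolutionOfSingularities.ResolutionOfSingularities.Theorems.SwitchingDichotomy

end
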